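import Summits.AtomisticToContinuum.Crystallization.Theorems.ChargedEnergyGapExposureDial

/-!
# `ChargedEnergyGap` · the RIGIDITY (improvability) DIAL on the compact residual (decomp-a2c lens-3 g43 node «RigidityDial»)

Beneath the exposure dial (`ChargedEnergyGapExposureDial`, landed): its residual of record is the compact gross gap
`CompactGrossGap θ ε R` — `κ` per charged, uncharted, well-bound, hole-free motif site —, read in the dense regime as the
`e*`-free `UniversalCompetitor (motifGrossCompact θ ε R) φ₀` at the dial of record `(θ, ε, R, φ₀) = (3/20, 1/10, 6/5, 1/100)`.

THE ZOO FIRST (critic row 856 (0); lens numerics, MEMO §1).  At `(3/20, 1/10, 6/5)` the compact gross charged species contains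
bcc (14-shell, `e − e(hcp) = +0.031`), the Bain family beyond its chart exit (exit is by SHELL COUNT at `c/a = 1.061`, excess there
`0.0297` — the floor of the standard zoo), A15 (`+0.086`; Z12 icosahedral shells, bottleneck `0.232` from the cuboctahedron, Z14),
C15 (`+0.129`), simple cubic (`+0.243`, six-shell yet not a rattler), and — decisive for the SHAPE of any local premium — OVER-BOUND
uncharted centres (a thirteen-shell at unit distance binds `≈ 0.115` below `2e(hcp)`, an isolated icosahedral centre `≈ 0.035`
below).  Hence a per-SITE frustration premium is FALSE-type, and a per-CLUSTER premium, though plausibly true, does not glue in the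
pricing world without a floor on the complement sharp at the Barlow environments (the cell's LocalCertificateBarrier).  Row 856's
(a) is therefore NOT typed; this file types its (b) «competitor locality / re-chartability», sharpened.

§1 LOCAL MODIFICATIONS.  `LocalMod r Q Q' x`: `Q'` has the lattice of `Q` and the two point sets agree at every point of space
   farther than `r` from the lattice orbit of `x`.  `Improvable r η Q x`: some local modification within radius `r` of the orbit of
   the motif site `x` lowers the excess `#F·(e − e*)` by at least `η` (for particle-number-preserving surgery the gain is `e*`-free,
   `#F·(e(Q) − e(Q'))`; in general `e*` enters only from ABOVE, through `excess Q' ≥ 0`).  A site that is not `(r, η)`-improvable is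
   `(r, η)`-RIGID: locally optimal frustration.
§2 THE DIAL (exact, every `θ ε R r η`): `CompactGrossGap θ ε R ↔ ImprovablePricing θ ε R r η ∧ RigidPricing θ ε R r η`
   (`compactGrossGap_iff_improvable_rigid`) — the compact gross charged motif sites split into improvable and rigid ones
   (`motifGrossCompact_eq_rigid_add_improvable`), and pricing is additive (`speciesPricing_add_iff`).  Both pieces are WEAKER than
   the residual (`improvablePricing_of_compactGrossGap`, `rigidPricing_of_compactGrossGap`) and than the crux.
§3 THE DIAL TURNS: improvability grows with `r` and shrinks with `η` (`Improvable.mono`), so the rigid residual weakens as `r ↑`,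
   `η ↓` (`rigidPricing_mono`); at the end `η ≤ 0` every site is improvable (`Q' := Q`), the rigid count vanishes and the improvable
   piece IS the compact gap (`improvablePricing_iff_compactGrossGap_of_nonpos`) — the dial interpolates honestly; record literals
   `(r, η) = (10, 1/100)`.
§4 BENEATH THE RESIDUAL: the regime split of the rigid species (`rigidPricing_iff_dense_dilute`); the universal competitor is
   ANTITONE in the species (`UniversalCompetitor.anti`), so the new dense residual
   `UniversalCompetitor (motifCompactRigid (3/20) (1/10) (6/5) 10 (1/100)) (1/100)` is WEAKER than the dense residual of record BY NAME
   (`universalCompetitor_rigid_record`); the FLAT-GAP reading `UniversalCompetitor c φ₀ ↔ FlatGap c φ₀` («the `φ₀`-dense class lies a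
   flat `δ` above ONE periodic competitor», `universalCompetitor_iff_flatGap`), monotonicity in `φ₀`, and the `φ₀ = 1` RUNG
   `TotalFrustrationGap` (totally frustrated periodic matter is gapped; zoo floor `0.0297`; an aside, not a piece of the cone).
§5 THE CONE BY NAME: `ExposedGrossPricing → ImprovablePricing → RigidPricing → ChartedChargePricing → ChargedEnergyGap`
   (`chargedEnergyGap_of_rigidityDial`), its regime form, the record instance, and the target of record from the two pieces
   (`universalCompetitor_compact_of_improvable_rigid`).

WHY THE RESIDUAL IS NOT THE SAME WALL (critic row 856 rule: no further local-EXPOSURE dial).  Exposure sorts sites by an observable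
of the configuration as it stands and always leaves ALL tcp / Frank–Kasper bulk order in the residual.  Improvability is VARIATIONAL:
a frustrated bulk species of excess density `Δe·ρ` and interface cost `γ` against a Barlow host is improvable at every radius
`r > 3γ/(Δe·ρ)` (volume beats surface: A15 `Δe = 0.086` gives `r₀ ≈ 7.5` at `γ = 0.3`), so at `r = 10` the rigid residual is expected to
hold only TOPOLOGICALLY PROTECTED frustration (relaxed dislocation arrays, grain boundaries, disclination networks — near-crystalline
away from the cores; engine: rigidity with incompatibility, Lauteri–Luckhaus / Garroni–Leoni–Ponsiglione lower bounds) and frustrated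
order below its nucleation threshold at that radius (engine: the total-frustration gap, §4's rung; census ask L3-NUC / L3-TF).  The
improvable piece is priced from ABOVE `e*` only (excess differences), the epistemic class of the exposed piece; its one new lemma is
the ADDITIVITY OF DISJOINT LOCAL SURGERIES (pair-potential cross terms between `r`-balls a distance `D` apart are `O(r⁶D⁻⁶)` tails).

No `sorry`, no new axiom, no instance / notation / option.  New `Prop`s: `LocalMod`, `Improvable`, `ImprovablePricing`,
`RigidPricing`, `FlatGap`, `TotalFrustrationGap`; new counts `motifCompactImprovable`, `motifCompactRigid`.
Cited: `natCard_subtype_split`, `speciesPricing_add_iff`, `speciesPricing_iff_dense_dilute`, `densePricing_of_universalCompetitor`,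
`universalCompetitor_of_densePricing`, `grossChargeGap_of_exposed_compact`, `chargedEnergyGap_of_pieces`, `excess_nonneg'`.
Concordance: route LoopTunnelDial's finite, grand-canonical surgery currency `LoopTunnelDialSieveCurrency.Improvable` /
`CanonImprovable` (ground states are canonically stable for free); here the periodic, excess-measured species must be PRICED.
-/

noncomputable section

open Literature.MathematicalPhysics.StatisticalMechanics
open Literature.Geometry.DiscreteGeometry
open Summit.AtomisticToContinuum.Crystallization.Theses.PricedLinkCensus
open Summit.AtomisticToContinuum.Crystallization.Theorems.ChargedEnergyGapNegative

namespace Summit.AtomisticToContinuum.Crystallization.Theorems.ChargedEnergyGapChartDial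

/-! ## §1 Local modifications and improvability -/

/-- `Q'` is a LOCAL MODIFICATION of `Q` supported within radius `r` of the orbit of the point `x`: same lattice of periods, and
membership in the two point sets agrees at every point of space that is farther than `r` from every lattice translate of `x`. -/
def LocalMod (r : ℝ) (Q Q' : PeriodicConfiguration 3) (x : E3) : Prop :=
  Q'.lattice = Q.lattice ∧ ∀ p : E3, (p ∈ Q.points ↔ p ∈ Q'.points) ∨ ∃ g ∈ Q.lattice, dist p (x + g) ≤ r

/-- The trivial modification. -/
theorem localMod_refl (r : ℝ) (Q : PeriodicConfiguration 3) (x : E3) : LocalMod r Q Q x :=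
  ⟨rfl, fun _ => Or.inl Iff.rfl⟩

/-- A modification within radius `r` is one within any larger radius. -/
theorem LocalMod.mono {r r' : ℝ} (h : r ≤ r') {Q Q' : PeriodicConfiguration 3} {x : E3} (hm : LocalMod r Q Q' x) :
    LocalMod r' Q Q' x :=
  ⟨hm.1, fun p => (hm.2 p).imp_right fun ⟨g, hg, hd⟩ => ⟨g, hg, hd.trans h⟩⟩

/-- **`(r, η)`-IMPROVABLE motif site**: some local modification within radius `r` of its orbit lowers the excess `#F·(e − e*)` by at
least `η`.  Its negation is `(r, η)`-RIGIDITY (local optimality of the frustration at `x`). -/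
def Improvable (r η : ℝ) (Q : PeriodicConfiguration 3) (x : Q.motif) : Prop :=
  ∃ Q' : PeriodicConfiguration 3, LocalMod r Q Q' x.1 ∧ excess Q' + η ≤ excess Q

/-- Improvability grows with the radius and shrinks with the required gain. -/
theorem Improvable.mono {r r' η η' : ℝ} (hr : r ≤ r') (hη : η' ≤ η) {Q : PeriodicConfiguration 3} {x : Q.motif}
    (h : Improvable r η Q x) : Improvable r' η' Q x := by
  obtain ⟨Q', hm, he⟩ := h
  exact ⟨Q', hm.mono hr, by linarith⟩

/-- Dial end: with a non-positive required gain every site is improvable (`Q' := Q`). -/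
theorem improvable_of_nonpos {r η : ℝ} (hη : η ≤ 0) (Q : PeriodicConfiguration 3) (x : Q.motif) : Improvable r η Q x :=
  ⟨Q, localMod_refl r Q x.1, by linarith⟩

/-- Number of compact gross charged motif sites that are `(r, η)`-improvable. -/
def motifCompactImprovable (θ ε R r η : ℝ) (Q : PeriodicConfiguration 3) : ℕ :=
  Nat.card {x : Q.motif // ((Charged Q x ∧ ¬ ChartedAt θ Q (pt Q x)) ∧ ¬ Exposed ε R Q x) ∧ Improvable r η Q x}

/-- Number of compact gross charged motif sites that are `(r, η)`-RIGID (not improvable): the residual species. -/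
def motifCompactRigid (θ ε R r η : ℝ) (Q : PeriodicConfiguration 3) : ℕ :=
  Nat.card {x : Q.motif // ((Charged Q x ∧ ¬ ChartedAt θ Q (pt Q x)) ∧ ¬ Exposed ε R Q x) ∧ ¬ Improvable r η Q x}

/-- The split of the compact residual species: rigid + improvable. -/
theorem motifGrossCompact_eq_rigid_add_improvable (θ ε R r η : ℝ) (Q : PeriodicConfiguration 3) :
    motifGrossCompact θ ε R Q = motifCompactRigid θ ε R r η Q + motifCompactImprovable θ ε R r η Q :=
  natCard_subtype_split (fun x : Q.motif => (Charged Q x ∧ ¬ ChartedAt θ Q (pt Q x)) ∧ ¬ Exposed ε R Q x)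
    (fun x => Improvable r η Q x)

/-- The rigid count is part of the compact count. -/
theorem motifCompactRigid_le (θ ε R r η : ℝ) (Q : PeriodicConfiguration 3) :
    motifCompactRigid θ ε R r η Q ≤ motifGrossCompact θ ε R Q := by
  rw [motifGrossCompact_eq_rigid_add_improvable θ ε R r η Q]; exact Nat.le_add_right _ _

/-- The improvable count is part of the compact count. -/
theorem motifCompactImprovable_le (θ ε R r η : ℝ) (Q : PeriodicConfiguration 3) :
    motifCompactImprovable θ ε R r η Q ≤ motifGrossCompact θ ε R Q := by
  rw [motifGrossCompact_eq_rigid_add_improvable θ ε R r η Q]; exact Nat.le_add_left _ _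

/-! ## §2 The pieces and the exact rigidity dial -/

/-- piece · WEAKER(proved `improvablePricing_of_compactGrossGap`) · TRUE-type for `η > 0` · ATTACKABLE-L/XL (additivity of disjoint
local surgeries on a `D`-separated sub-net of improvable orbits, cross terms `O(r⁶D⁻⁶)`; local cardinality bounded after crowding
pricing, part D) · priced from ABOVE `e*` only.  **Improvable pricing**: `κ` per compact gross charged motif site that is
`(r, η)`-improvable.  (At `η ≤ 0` this piece IS the compact gap: `improvablePricing_iff_compactGrossGap_of_nonpos`.) -/
def ImprovablePricing (θ ε R r η : ℝ) : Prop :=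
  ∃ κ : ℝ, 0 < κ ∧ ∀ Q : PeriodicConfiguration 3, κ * (motifCompactImprovable θ ε R r η Q : ℝ) ≤ excess Q

/-- piece · WEAKER(proved `rigidPricing_of_compactGrossGap`) · NEW RESIDUAL OF THE GROSS SIDE · UNDECIDED(test: which species of the zoo
are `(10, 1/100)`-rigid — relaxed dislocation dipole arrays and grain boundaries are (topological protection); A15 / C15 / sc / bcc bulk
are expected improvable beyond their nucleation radii `3γ/(Δe·ρ)`; census asks L3-NUC, L3-TF) · INSTRUMENTABLE · IDEA-NEEDED (rigidity
with incompatibility for protected textures; the total-frustration gap for sub-nucleation order) · BARRIER-ringed (TetrahedralFrustration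
for the sub-nucleation part; LocalCertificateBarrier NOT in its sharp form: protected textures are near-crystalline away from cores).
**Rigid pricing**: `κ` per compact gross charged motif site that is `(r, η)`-rigid. -/
def RigidPricing (θ ε R r η : ℝ) : Prop :=
  ∃ κ : ℝ, 0 < κ ∧ ∀ Q : PeriodicConfiguration 3, κ * (motifCompactRigid θ ε R r η Q : ℝ) ≤ excess Q

/-- The compact gap is the pricing of the compact count (definitional). -/
theorem compactGrossGap_iff_speciesPricing (θ ε R : ℝ) :
    CompactGrossGap θ ε R ↔ SpeciesPricing (motifGrossCompact θ ε R) := Iff.rfl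

/-- The improvable piece is the pricing of the improvable count (definitional). -/
theorem improvablePricing_iff_speciesPricing (θ ε R r η : ℝ) :
    ImprovablePricing θ ε R r η ↔ SpeciesPricing (motifCompactImprovable θ ε R r η) := Iff.rfl

/-- The rigid piece is the pricing of the rigid count (definitional). -/
theorem rigidPricing_iff_speciesPricing (θ ε R r η : ℝ) :
    RigidPricing θ ε R r η ↔ SpeciesPricing (motifCompactRigid θ ε R r η) := Iff.rfl

/-- **THE RIGIDITY DIAL IS EXACT**: for every `θ ε R r η`,
`CompactGrossGap θ ε R ↔ ImprovablePricing θ ε R r η ∧ RigidPricing θ ε R r η`. -/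
theorem compactGrossGap_iff_improvable_rigid (θ ε R r η : ℝ) :
    CompactGrossGap θ ε R ↔ ImprovablePricing θ ε R r η ∧ RigidPricing θ ε R r η := by
  rw [compactGrossGap_iff_speciesPricing,
    speciesPricing_congr (c' := fun Q => motifCompactImprovable θ ε R r η Q + motifCompactRigid θ ε R r η Q)
      (fun Q => by rw [motifGrossCompact_eq_rigid_add_improvable θ ε R r η Q, add_comm]),
    speciesPricing_add_iff]
  exact Iff.rfl

/-- The glue of the dial: the two pieces give the compact residual. -/
theorem compactGrossGap_of_improvable_rigid {θ ε R r η : ℝ} (hI : ImprovablePricing θ ε R r η)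
    (hR : RigidPricing θ ε R r η) : CompactGrossGap θ ε R :=
  (compactGrossGap_iff_improvable_rigid θ ε R r η).2 ⟨hI, hR⟩

/-- WEAKER certificate: the improvable piece is implied by the compact residual. -/
theorem improvablePricing_of_compactGrossGap {θ ε R : ℝ} (r η : ℝ) (h : CompactGrossGap θ ε R) :
    ImprovablePricing θ ε R r η :=
  ((compactGrossGap_iff_improvable_rigid θ ε R r η).1 h).1

/-- WEAKER certificate: the rigid residual is implied by the compact residual. -/
theorem rigidPricing_of_compactGrossGap {θ ε R : ℝ} (r η : ℝ) (h : CompactGrossGap θ ε R) : RigidPricing θ ε R r η :=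
  ((compactGrossGap_iff_improvable_rigid θ ε R r η).1 h).2

/-- … and both by the crux itself. -/
theorem improvablePricing_of_chargedEnergyGap (θ ε R r η : ℝ) (h : ChargedEnergyGap) : ImprovablePricing θ ε R r η :=
  improvablePricing_of_compactGrossGap r η (compactGrossGap_of_chargedEnergyGap θ ε R h)

/-- `rigidPricing_of_chargedEnergyGap` (the residual is implied by the crux). [formal bookkeeping] -/
theorem rigidPricing_of_chargedEnergyGap (θ ε R r η : ℝ) (h : ChargedEnergyGap) : RigidPricing θ ε R r η :=
  rigidPricing_of_compactGrossGap r η (compactGrossGap_of_chargedEnergyGap θ ε R h)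

/-! ## §3 The dial in `(r, η)` and its end -/

/-- More sites are improvable at larger radius / smaller gain. -/
theorem motifCompactImprovable_mono {θ ε R r r' η η' : ℝ} (hr : r ≤ r') (hη : η' ≤ η) (Q : PeriodicConfiguration 3) :
    motifCompactImprovable θ ε R r η Q ≤ motifCompactImprovable θ ε R r' η' Q :=
  Nat.card_le_card_of_injective
    (fun x : {x : Q.motif // ((Charged Q x ∧ ¬ ChartedAt θ Q (pt Q x)) ∧ ¬ Exposed ε R Q x) ∧ Improvable r η Q x} =>
      (⟨x.1, x.2.1, x.2.2.mono hr hη⟩ :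
        {x : Q.motif // ((Charged Q x ∧ ¬ ChartedAt θ Q (pt Q x)) ∧ ¬ Exposed ε R Q x) ∧ Improvable r' η' Q x}))
    (fun x y hxy => Subtype.ext (by have h' := congrArg Subtype.val hxy; simpa using h'))

/-- Fewer sites are rigid at larger radius / smaller gain: the residual species SHRINKS along the dial. -/
theorem motifCompactRigid_anti {θ ε R r r' η η' : ℝ} (hr : r ≤ r') (hη : η' ≤ η) (Q : PeriodicConfiguration 3) :
    motifCompactRigid θ ε R r' η' Q ≤ motifCompactRigid θ ε R r η Q :=
  Nat.card_le_card_of_injective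
    (fun x : {x : Q.motif // ((Charged Q x ∧ ¬ ChartedAt θ Q (pt Q x)) ∧ ¬ Exposed ε R Q x) ∧ ¬ Improvable r' η' Q x} =>
      (⟨x.1, x.2.1, fun h => x.2.2 (h.mono hr hη)⟩ :
        {x : Q.motif // ((Charged Q x ∧ ¬ ChartedAt θ Q (pt Q x)) ∧ ¬ Exposed ε R Q x) ∧ ¬ Improvable r η Q x}))
    (fun x y hxy => Subtype.ext (by have h' := congrArg Subtype.val hxy; simpa using h'))

/-- **The residual weakens along the dial**: `RigidPricing θ ε R r η → RigidPricing θ ε R r' η'` for `r ≤ r'`, `η' ≤ η`. -/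
theorem rigidPricing_mono {θ ε R r r' η η' : ℝ} (hr : r ≤ r') (hη : η' ≤ η) (h : RigidPricing θ ε R r η) :
    RigidPricing θ ε R r' η' :=
  SpeciesPricing.mono h (motifCompactRigid_anti hr hη)

/-- … while the improvable piece strengthens: `ImprovablePricing θ ε R r' η' → ImprovablePricing θ ε R r η`. -/
theorem improvablePricing_anti {θ ε R r r' η η' : ℝ} (hr : r ≤ r') (hη : η' ≤ η) (h : ImprovablePricing θ ε R r' η') :
    ImprovablePricing θ ε R r η :=
  SpeciesPricing.mono h (motifCompactImprovable_mono hr hη)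

/-- Dial end: at `η ≤ 0` no site is rigid. -/
theorem motifCompactRigid_eq_zero_of_nonpos {θ ε R r η : ℝ} (hη : η ≤ 0) (Q : PeriodicConfiguration 3) :
    motifCompactRigid θ ε R r η Q = 0 := by
  haveI : IsEmpty {x : Q.motif // ((Charged Q x ∧ ¬ ChartedAt θ Q (pt Q x)) ∧ ¬ Exposed ε R Q x) ∧ ¬ Improvable r η Q x} :=
    ⟨fun x => x.2.2 (improvable_of_nonpos hη Q x.1)⟩
  exact Nat.card_of_isEmpty

/-- Dial end: at `η ≤ 0` the rigid residual holds trivially. -/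
theorem rigidPricing_of_nonpos {θ ε R r η : ℝ} (hη : η ≤ 0) : RigidPricing θ ε R r η :=
  ⟨1, one_pos, fun Q => by rw [motifCompactRigid_eq_zero_of_nonpos hη Q]; simpa using excess_nonneg' Q⟩

/-- Dial end: at `η ≤ 0` the improvable piece IS the compact residual (so the dial interpolates between the target and the new
residual; it carries content only for `η > 0`). -/
theorem improvablePricing_iff_compactGrossGap_of_nonpos {θ ε R r η : ℝ} (hη : η ≤ 0) :
    ImprovablePricing θ ε R r η ↔ CompactGrossGap θ ε R := by
  rw [compactGrossGap_iff_improvable_rigid θ ε R r η]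
  exact ⟨fun h => ⟨h, rigidPricing_of_nonpos hη⟩, fun h => h.1⟩

/-! ## §4 Beneath the residual: regime split, antitonicity of the universal competitor, the flat-gap reading, the `φ₀ = 1` rung -/

/-- The rigid residual splits by regime (exact). -/
theorem rigidPricing_iff_dense_dilute (θ ε R r η φ₀ : ℝ) :
    RigidPricing θ ε R r η ↔
      DensePricing (motifCompactRigid θ ε R r η) φ₀ ∧ DilutePricing (motifCompactRigid θ ε R r η) φ₀ :=
  speciesPricing_iff_dense_dilute _ _

/-- **The universal competitor is ANTITONE in the species**: a sub-count inherits it (same `B`, same `κ`; the dense guard of the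
sub-count implies the dense guard of the count). -/
theorem UniversalCompetitor.anti {c c' : PeriodicConfiguration 3 → ℕ} {φ₀ : ℝ} (h : UniversalCompetitor c φ₀)
    (hle : ∀ Q, c' Q ≤ c Q) : UniversalCompetitor c' φ₀ := by
  obtain ⟨B, κ, hκ, h⟩ := h
  refine ⟨B, κ, hκ, fun Q hd => ?_⟩
  have hle' : (c' Q : ℝ) ≤ c Q := Nat.cast_le.2 (hle Q)
  exact (mul_le_mul_of_nonneg_left hle' hκ.le).trans (h Q (hd.trans hle'))

/-- The dense regime is antitone in the species likewise. -/
theorem DensePricing.anti {c c' : PeriodicConfiguration 3 → ℕ} {φ₀ : ℝ} (h : DensePricing c φ₀) (hle : ∀ Q, c' Q ≤ c Q) :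
    DensePricing c' φ₀ := by
  obtain ⟨κ, hκ, h⟩ := h
  refine ⟨κ, hκ, fun Q hd => ?_⟩
  have hle' : (c' Q : ℝ) ≤ c Q := Nat.cast_le.2 (hle Q)
  exact (mul_le_mul_of_nonneg_left hle' hκ.le).trans (h Q (hd.trans hle'))

/-- The universal competitor is MONOTONE in the threshold: a larger `φ₀` restricts the dense class. -/
theorem UniversalCompetitor.mono_phi {c : PeriodicConfiguration 3 → ℕ} {φ₀ φ₁ : ℝ} (hφ : φ₀ ≤ φ₁)
    (h : UniversalCompetitor c φ₀) : UniversalCompetitor c φ₁ := by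
  obtain ⟨B, κ, hκ, h⟩ := h
  exact ⟨B, κ, hκ, fun Q hd => h Q ((mul_le_mul_of_nonneg_right hφ (Nat.cast_nonneg _)).trans hd)⟩

/-- The dense rigid residual is implied by the dense compact residual, every `θ ε R r η φ₀`. -/
theorem universalCompetitor_rigid_of_compact {θ ε R φ₀ : ℝ} (r η : ℝ)
    (h : UniversalCompetitor (motifGrossCompact θ ε R) φ₀) : UniversalCompetitor (motifCompactRigid θ ε R r η) φ₀ :=
  h.anti (motifCompactRigid_le θ ε R r η)

/-- ★ **The new dense residual is WEAKER than the dense residual of record, by name.** -/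
theorem universalCompetitor_rigid_record
    (h : UniversalCompetitor (motifGrossCompact (3 / 20) (1 / 10) (6 / 5)) (1 / 100)) :
    UniversalCompetitor (motifCompactRigid (3 / 20) (1 / 10) (6 / 5) 10 (1 / 100)) (1 / 100) :=
  universalCompetitor_rigid_of_compact 10 (1 / 100) h

/-- **Flat gap**: the `φ₀`-dense class of the count `c` lies a flat `δ > 0` above ONE periodic competitor `B`. -/
def FlatGap (c : PeriodicConfiguration 3 → ℕ) (φ₀ : ℝ) : Prop :=
  ∃ B : PeriodicConfiguration 3, ∃ δ : ℝ, 0 < δ ∧ ∀ Q : PeriodicConfiguration 3,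
    φ₀ * (Q.motif.card : ℝ) ≤ (c Q : ℝ) → B.energyPerParticle lennardJones + δ ≤ Q.energyPerParticle lennardJones

/-- A count of motif sites is at most the motif size. -/
theorem motifSubtypeCard_le (Q : PeriodicConfiguration 3) (P : Q.motif → Prop) :
    Nat.card {x : Q.motif // P x} ≤ Q.motif.card := by
  calc Nat.card {x : Q.motif // P x} ≤ Nat.card Q.motif :=
        Nat.card_le_card_of_injective (fun x => x.1) Subtype.val_injective
    _ = Q.motif.card := by rw [Nat.card_eq_fintype_card, Fintype.card_coe]

/-- The compact count is at most the motif size. -/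
theorem motifGrossCompact_le_card (θ ε R : ℝ) (Q : PeriodicConfiguration 3) : motifGrossCompact θ ε R Q ≤ Q.motif.card :=
  motifSubtypeCard_le Q _

/-- The rigid count is at most the motif size. -/
theorem motifCompactRigid_le_card (θ ε R r η : ℝ) (Q : PeriodicConfiguration 3) :
    motifCompactRigid θ ε R r η Q ≤ Q.motif.card :=
  motifSubtypeCard_le Q _

/-- **The universal competitor IS a flat gap** for a count bounded by the motif size and `φ₀ > 0`: in the dense regime
`κ·c ≥ κφ₀·#F` is extensive, so «`κ` per member» and «`δ` per particle» are the same statement (`δ = κφ₀`, `κ = δ`). -/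
theorem universalCompetitor_iff_flatGap {c : PeriodicConfiguration 3 → ℕ} {φ₀ : ℝ} (hφ : 0 < φ₀)
    (hc : ∀ Q, c Q ≤ Q.motif.card) : UniversalCompetitor c φ₀ ↔ FlatGap c φ₀ := by
  constructor
  · rintro ⟨B, κ, hκ, h⟩
    refine ⟨B, κ * φ₀, by positivity, fun Q hd => ?_⟩
    have hF : (0 : ℝ) < Q.motif.card := by exact_mod_cast Q.motif_nonempty.card_pos
    have h1 := h Q hd
    have h2 : κ * (φ₀ * (Q.motif.card : ℝ)) ≤ κ * (c Q : ℝ) := mul_le_mul_of_nonneg_left hd hκ.le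
    have h3 : (Q.motif.card : ℝ) * (κ * φ₀) ≤
        (Q.motif.card : ℝ) * (Q.energyPerParticle lennardJones - B.energyPerParticle lennardJones) := by
      have : (Q.motif.card : ℝ) * (κ * φ₀) = κ * (φ₀ * (Q.motif.card : ℝ)) := by ring
      rw [this]; exact h2.trans h1
    have h4 := le_of_mul_le_mul_left h3 hF
    linarith
  · rintro ⟨B, δ, hδ, h⟩
    refine ⟨B, δ, hδ, fun Q hd => ?_⟩
    have hcF : (c Q : ℝ) ≤ Q.motif.card := by exact_mod_cast hc Q
    have h1 := h Q hd
    have hc0 : (0 : ℝ) ≤ c Q := Nat.cast_nonneg _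
    calc δ * (c Q : ℝ) ≤ δ * (Q.motif.card : ℝ) := mul_le_mul_of_nonneg_left hcF hδ.le
      _ ≤ (Q.motif.card : ℝ) * (Q.energyPerParticle lennardJones - B.energyPerParticle lennardJones) := by
          rw [mul_comm]; exact mul_le_mul_of_nonneg_left (by linarith) (Nat.cast_nonneg _)

/-- The dense residual of record, read as a flat gap. -/
theorem universalCompetitor_compact_iff_flatGap {θ ε R φ₀ : ℝ} (hφ : 0 < φ₀) :
    UniversalCompetitor (motifGrossCompact θ ε R) φ₀ ↔ FlatGap (motifGrossCompact θ ε R) φ₀ :=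
  universalCompetitor_iff_flatGap hφ (motifGrossCompact_le_card θ ε R)

/-- The new dense residual, read as a flat gap. -/
theorem universalCompetitor_rigid_iff_flatGap {θ ε R r η φ₀ : ℝ} (hφ : 0 < φ₀) :
    UniversalCompetitor (motifCompactRigid θ ε R r η) φ₀ ↔ FlatGap (motifCompactRigid θ ε R r η) φ₀ :=
  universalCompetitor_iff_flatGap hφ (motifCompactRigid_le_card θ ε R r η)

/-- rung (aside; not a piece of the cone) · WEAKER(proved `totalFrustrationGap_of_universalCompetitor`) · UNDECIDED(test: a periodic
structure all of whose motif sites are compact gross charged at `(3/20, 1/10, 6/5)` within `10⁻³` of `e(hcp)`; zoo floor `0.0297` at the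
Bain exit, bcc `0.031`, A15 `0.086`, C15 `0.129`) · INSTRUMENTABLE · BARRIER TetrahedralFrustration head-on, LocalCertificateBarrier not
in its sharp form (no Barlow environment in the class).  **Total-frustration gap**: the `φ₀ = 1` end of the dense dial — periodic matter
ALL of whose motif sites are compact gross charged lies a flat `δ` above one periodic competitor. -/
def TotalFrustrationGap (θ ε R : ℝ) : Prop :=
  UniversalCompetitor (motifGrossCompact θ ε R) 1

/-- The rung is below every dense residual with `φ₀ ≤ 1`. -/
theorem totalFrustrationGap_of_universalCompetitor {θ ε R φ₀ : ℝ} (hφ : φ₀ ≤ 1)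
    (h : UniversalCompetitor (motifGrossCompact θ ε R) φ₀) : TotalFrustrationGap θ ε R :=
  h.mono_phi hφ

/-- The rung, read as a flat gap on totally frustrated periodic matter. -/
theorem totalFrustrationGap_iff_flatGap (θ ε R : ℝ) :
    TotalFrustrationGap θ ε R ↔ FlatGap (motifGrossCompact θ ε R) 1 :=
  universalCompetitor_iff_flatGap one_pos (motifGrossCompact_le_card θ ε R)

/-- The rung at the dial of record is below the dense residual of record. -/
theorem totalFrustrationGap_record (h : UniversalCompetitor (motifGrossCompact (3 / 20) (1 / 10) (6 / 5)) (1 / 100)) :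
    TotalFrustrationGap (3 / 20) (1 / 10) (6 / 5) :=
  totalFrustrationGap_of_universalCompetitor (by norm_num) h

/-! ## §5 The assembled cone -/

/-- The gross piece from the three G-side pieces: exposed ∧ improvable ∧ rigid. -/
theorem grossChargeGap_of_rigidityDial {θ ε R r η : ℝ} (hE : ExposedGrossPricing θ ε R) (hI : ImprovablePricing θ ε R r η)
    (hR : RigidPricing θ ε R r η) : GrossChargeGap θ :=
  grossChargeGap_of_exposed_compact hE (compactGrossGap_of_improvable_rigid hI hR)

/-- **The crux by name**: exposed ∧ improvable ∧ rigid ∧ charted pricing ⟹ `ChargedEnergyGap`. -/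
theorem chargedEnergyGap_of_rigidityDial {θ ε R r η : ℝ} (hE : ExposedGrossPricing θ ε R) (hI : ImprovablePricing θ ε R r η)
    (hR : RigidPricing θ ε R r η) (hP : ChartedChargePricing θ) : ChargedEnergyGap :=
  chargedEnergyGap_of_pieces (grossChargeGap_of_rigidityDial hE hI hR) hP

/-- … with the rigid residual in regime form (universal competitor for rigid-frustration-dense matter ∧ dilute rigid pricing). -/
theorem chargedEnergyGap_of_rigidityDial_regime {θ ε R r η φ₀ : ℝ} (hE : ExposedGrossPricing θ ε R)
    (hI : ImprovablePricing θ ε R r η) (hU : UniversalCompetitor (motifCompactRigid θ ε R r η) φ₀)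
    (hD : DilutePricing (motifCompactRigid θ ε R r η) φ₀) (hP : ChartedChargePricing θ) : ChargedEnergyGap :=
  chargedEnergyGap_of_rigidityDial hE hI
    ((rigidPricing_iff_dense_dilute θ ε R r η φ₀).2 ⟨densePricing_of_universalCompetitor hU, hD⟩) hP

/-- ★ **Record instance** `(θ, ε, R, r, η, φ₀) = (3/20, 1/10, 6/5, 10, 1/100, 1/100)`. -/
theorem chargedEnergyGap_of_rigidityDial_record (hE : ExposedGrossPricing (3 / 20) (1 / 10) (6 / 5))
    (hI : ImprovablePricing (3 / 20) (1 / 10) (6 / 5) 10 (1 / 100))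
    (hU : UniversalCompetitor (motifCompactRigid (3 / 20) (1 / 10) (6 / 5) 10 (1 / 100)) (1 / 100))
    (hD : DilutePricing (motifCompactRigid (3 / 20) (1 / 10) (6 / 5) 10 (1 / 100)) (1 / 100))
    (hP : ChartedChargePricing (3 / 20)) : ChargedEnergyGap :=
  chargedEnergyGap_of_rigidityDial_regime hE hI hU hD hP

/-- **The target of record from the two pieces**: improvable ∧ rigid ⟹ the dense compact residual (every `φ₀ > 0`). -/
theorem universalCompetitor_compact_of_improvable_rigid {θ ε R r η φ₀ : ℝ} (hφ : 0 < φ₀)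
    (hI : ImprovablePricing θ ε R r η) (hR : RigidPricing θ ε R r η) :
    UniversalCompetitor (motifGrossCompact θ ε R) φ₀ :=
  universalCompetitor_of_densePricing hφ
    ((compactGrossGap_iff_dense_dilute θ ε R φ₀).1 (compactGrossGap_of_improvable_rigid hI hR)).1

/-- ★ The target of record `UniversalCompetitor (motifGrossCompact (3/20) (1/10) (6/5)) (1/100)` from the record pieces. -/
theorem universalCompetitor_compact_record_of_rigidityDial
    (hI : ImprovablePricing (3 / 20) (1 / 10) (6 / 5) 10 (1 / 100)) (hR : RigidPricing (3 / 20) (1 / 10) (6 / 5) 10 (1 / 100)) :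
    UniversalCompetitor (motifGrossCompact (3 / 20) (1 / 10) (6 / 5)) (1 / 100) :=
  universalCompetitor_compact_of_improvable_rigid (by norm_num) hI hR

end Summit.AtomisticToContinuum.Crystallization.Theorems.ChargedEnergyGapChartDial

end
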